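import Summits.ABC.IUTFork.Cor312StatementBridges
import HarnessLib

/-!
# [IUTchIII] Corollary 3.12 under the identified-copies reading: a non-vacuous witness, I — sign shells

Record-only file (D-0012) of the abc-iut cell (D-0067 overnight push, wave-4 prover abc-iut-w4-d101 for
Cor. 3.12 STRATEGY TEAM R «refutation (identified-copies reading)», lead R1 = abc-iut-c312-14); TAKES NO
SIDE. Part I of the NON-VACUITY WITNESS for Team R's hypothesis `Cor312.Setting.IdentifiedReading` (R-1,
`Cor312IdentifiedCopies.lean`) that `HOME/plan/ADJUDICATION-SPEC.md` v1.1 §2 (R) / §4 (iii) asks for ("an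
`IdentifiedReading` instance with NON-EMPTY regions and `AbsLogQPos`"; the landed `identifiedToy` has empty
pilot regions). This part is the (Ind1)(Ind2)-side bookkeeping, over c312-1's signature
(`Thm311.LogShells`, `Ind1Family`, `Ind2Family`) and c312-7's one-place index `Cor312.Checks.toyIndex`:

* `signShells` — carrier `ℚ`, shell the unit ball, strip-automorphisms and "Ism" both the SIGN GROUP
  `{±1}` ([IUTchIII] Prop. 1.2 (vii): "the independent actions of `{±1}` on each of the direct factors");
  its `(j+1)`-tensor packets are `ℚ`-lines (`line j vQ : Packet ≃ₗ[ℚ] ℚ`, `line_tprod`).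
* `actsBySigns_of_mem_closure` — EVERY element of the group generated by the (Ind1)-families (a
  permutation of the capsule `S^±_{j+1}` and strip-automorphisms on every summand of every factor) and the
  (Ind2)-families (independent signs) acts on each packet line as multiplication by some `ε`, `|ε| = 1`
  (pure-tensor computation `factorwise_eq_smul` / `line_permute` + `Subgroup.closure_induction`).
* `ball` — the region `{x | |line x| ≤ 1}`: NONEMPTY (`ball_nonempty`), not `{0}` (`ball_ne_zero`), not
  everything (`ball_ne_univ`), and FIXED as a set by every family acting by signs
  (`image_ball_of_actsBySigns`) — while `negFamily` (the (Ind2)-family "`−1` everywhere") MOVES its points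
  (`negFamily_moves`): the indeterminacies act "along the identity" on the region without being the identity.

Part II (`Cor312IdentifiedNonVacuity.lean`) builds the verbatim `Cor312.Setting` on these packets and proves
`IdentifiedReading`, `AbsLogQPos`, `BridgeHyps`, `Statement`. HONEST SCOPE: consistency bookkeeping for a
typed hypothesis; nothing here bears on which reading of [IUTchIII] Thm. 3.11 / Cor. 3.12 Step (xi) is the
right one. [cite: ScholzeStix2018, §2.2 pp. 9–10] for the reading; [claim: Mochizuki2012, status: disputed]
for the Corollary. No new `Prop` facts; standard axioms.
-/

noncomputable section

namespace Summit.ABC.IUTFork.Cor312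

namespace IdentifiedNonVacuity

open Thm311 Cor312.Checks Literature.IUT.LogThetaLattice

/-! ## 1. The sign shells: `ℚ`-lines with the `{±1}`-indeterminacy -/

/-- The fibre of c312-7's one-place index over its place is a one-point type. [folklore] -/
@[reducible] def toyFibreUnique (vQ : toyIndex.VQ) : Unique (toyIndex.Fibre vQ) where
  default := ⟨(), rfl⟩
  uniq := fun a => Subtype.ext (by
    haveI : Subsingleton toyIndex.V := inferInstanceAs (Subsingleton Unit)
    exact Subsingleton.elim _ _)

/-- The sign group `{+1, −1}` acting on `ℚ` ("the independent actions of `{±1}` on each of the direct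
factors", [IUTchIII] Prop. 1.2 (vii)). [claim: Mochizuki2012, status: disputed] -/
def signs : Set (ℚ ≃ₗ[ℚ] ℚ) := {LinearEquiv.refl ℚ ℚ, LinearEquiv.neg ℚ}

/-- An element of the sign group is multiplication by some `s` with `|s| = 1`. [folklore] -/
theorem exists_eq_mul_of_mem_signs {g : ℚ ≃ₗ[ℚ] ℚ} (hg : g ∈ signs) :
    ∃ s : ℚ, |s| = 1 ∧ ∀ y : ℚ, g y = s * y := by
  rcases hg with rfl | rfl
  · exact ⟨1, abs_one, fun y => by simp⟩
  · exact ⟨-1, by simp, fun y => by simp [LinearEquiv.neg_apply]⟩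

/-- `log(D⊢_v) := ℚ`, log-shell the unit ball, strip-automorphisms and "Ism" both the sign group `{±1}`.
(An `abbrev`, so that `signShells.carrier v` reduces to `ℚ` for instance search.)
[claim: Mochizuki2012, status: disputed] -/
abbrev signShells : LogShells toyIndex where
  carrier := fun _ => ℚ
  shell := fun _ => {x | |x| ≤ 1}
  stripAut := fun _ => signs
  ism := fun _ => signs
  one_mem_stripAut := fun _ => Set.mem_insert _ _
  one_mem_ism := fun _ => Set.mem_insert _ _

/-- The `(j+1)`-tensor packet of the sign shells is a `ℚ`-LINE: every 1-packet is `Fibre → ℚ ≃ ℚ` (one-point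
fibre) and the tensor power of `ℚ` over the capsule `S^±_{j+1}` is `ℚ`. [folklore] -/
def line (j : toyIndex.Label) (vQ : toyIndex.VQ) : signShells.Packet j vQ ≃ₗ[ℚ] ℚ :=
  haveI := toyFibreUnique vQ
  (PiTensorProduct.congr fun _ : toyIndex.Caps j =>
      LinearEquiv.funUnique (toyIndex.Fibre vQ) ℚ ℚ).trans
    (PiTensorProduct.constantBaseRingEquiv (toyIndex.Caps j) ℚ).toLinearEquiv

/-- The line coordinate of a pure tensor is the product of the coordinates of its factors. [folklore] -/
theorem line_tprod (j : toyIndex.Label) (vQ : toyIndex.VQ) (x : toyIndex.Caps j → signShells.Packet1 vQ) :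
    line j vQ (PiTensorProduct.tprod ℚ x) = ∏ i, (x i ⟨(), rfl⟩ : ℚ) := by
  haveI := toyFibreUnique vQ
  unfold line
  erw [LinearEquiv.trans_apply, PiTensorProduct.congr_tprod, AlgEquiv.toLinearEquiv_apply,
    PiTensorProduct.constantBaseRingEquiv_tprod]
  rfl


/-! ## 2. The (Ind1)(Ind2)-generators act on every packet line by signs -/

/-- A packet-automorphism family ACTS BY SIGNS if on every packet line it is multiplication by some `ε`
with `|ε| = 1` — the property propagated through the group generated by (Ind1), (Ind2) (a one-field
structure: a local bookkeeping predicate, not a fact). [folklore] -/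
structure ActsBySigns (Φ : signShells.PacketAut) : Prop where
  /-- on every packet line `Φ` is multiplication by a sign -/
  sign : ∀ (j : toyIndex.Label) (vQ : toyIndex.VQ), ∃ ε : ℚ, |ε| = 1 ∧
    ∀ x : signShells.Packet j vQ, line j vQ (Φ j vQ x) = ε * line j vQ x

/-- A summand-wise sign automorphism of the 1-packet `Fibre → ℚ` (one-point fibre) is a sign multiple of
the identity. [folklore] -/
theorem summandwise_eq_smul (vQ : toyIndex.VQ)
    (g : ∀ v : toyIndex.Fibre vQ, signShells.carrier v.1 ≃ₗ[ℚ] signShells.carrier v.1)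
    (hg : ∀ v, g v ∈ signs) :
    ∃ s : ℚ, |s| = 1 ∧ ∀ y : signShells.Packet1 vQ, signShells.summandwise vQ g y = s • y := by
  haveI := toyFibreUnique vQ
  obtain ⟨s, hs, hgs⟩ := exists_eq_mul_of_mem_signs (hg default)
  refine ⟨s, hs, fun y => ?_⟩
  funext v
  rw [Unique.eq_default v]
  exact hgs _

/-- A factor-wise automorphism of the tensor packet by scalar multiples `s_i • (−)` is the scalar
`∏ s_i` on the packet (multilinearity of `⊗`). [folklore] -/
theorem factorwise_eq_smul (j : toyIndex.Label) (vQ : toyIndex.VQ)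
    (e : toyIndex.Caps j → (signShells.Packet1 vQ ≃ₗ[ℚ] signShells.Packet1 vQ))
    (s : toyIndex.Caps j → ℚ) (he : ∀ i y, e i y = s i • y) (x : signShells.Packet j vQ) :
    signShells.factorwise j vQ e x = (∏ i, s i) • x := by
  have h : (signShells.factorwise j vQ e).toLinearMap = (∏ i, s i) • LinearMap.id := by
    apply PiTensorProduct.ext
    ext y
    simp only [LinearMap.compMultilinearMap_apply]
    show signShells.factorwise j vQ e (PiTensorProduct.tprod ℚ y) = _
    unfold LogShells.factorwise
    erw [PiTensorProduct.congr_tprod]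
    have hy : (fun i => e i (y i)) = fun i => s i • y i := funext fun i => he i (y i)
    rw [hy, MultilinearMap.map_smul_univ]
    rfl
  exact congrArg (fun f : signShells.Packet j vQ →ₗ[ℚ] signShells.Packet j vQ => f x) h

/-- … hence multiplies the line coordinate by `∏ s_i`. [folklore] -/
theorem line_factorwise_of_smul (j : toyIndex.Label) (vQ : toyIndex.VQ)
    (e : toyIndex.Caps j → (signShells.Packet1 vQ ≃ₗ[ℚ] signShells.Packet1 vQ))
    (s : toyIndex.Caps j → ℚ) (he : ∀ i y, e i y = s i • y) (x : signShells.Packet j vQ) :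
    line j vQ (signShells.factorwise j vQ e x) = (∏ i, s i) * line j vQ x := by
  rw [factorwise_eq_smul j vQ e s he, map_smul, smul_eq_mul]

/-- A permutation of the capsule permutes the factors of a pure tensor. [folklore] -/
theorem permute_tprod (j : toyIndex.Label) (vQ : toyIndex.VQ) (σ : Equiv.Perm (toyIndex.Caps j))
    (y : toyIndex.Caps j → signShells.Packet1 vQ) :
    signShells.permute j vQ σ (PiTensorProduct.tprod ℚ y) = PiTensorProduct.tprod ℚ fun i => y (σ.symm i) :=
  PiTensorProduct.reindex_tprod σ y

/-- A permutation of the tensor factors does not change the line coordinate (the product of the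
coordinates is symmetric). [folklore] -/
theorem line_permute (j : toyIndex.Label) (vQ : toyIndex.VQ) (σ : Equiv.Perm (toyIndex.Caps j))
    (x : signShells.Packet j vQ) : line j vQ (signShells.permute j vQ σ x) = line j vQ x := by
  have h : (line j vQ).toLinearMap ∘ₗ (signShells.permute j vQ σ).toLinearMap =
      (line j vQ).toLinearMap := by
    apply PiTensorProduct.ext
    ext y
    simp only [LinearMap.compMultilinearMap_apply]
    show line j vQ (signShells.permute j vQ σ (PiTensorProduct.tprod ℚ y)) =
      line j vQ (PiTensorProduct.tprod ℚ y)
    rw [permute_tprod, line_tprod, line_tprod]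
    exact Equiv.prod_comp σ.symm fun i => (y i ⟨(), rfl⟩ : ℚ)
  exact congrArg (fun f : signShells.Packet j vQ →ₗ[ℚ] ℚ => f x) h

/-- A product of numbers of absolute value `1` has absolute value `1`. [folklore] -/
theorem abs_prod_eq_one {ι : Type} [Fintype ι] {s : ι → ℚ} (hs : ∀ i, |s i| = 1) : |∏ i, s i| = 1 := by
  rw [Finset.abs_prod]
  exact Finset.prod_eq_one fun i _ => hs i

/-- Every (Ind2)-family ("independent copies of Ism = `{±1}` on each direct summand of each factor") acts by
signs. [folklore] -/
theorem actsBySigns_of_mem_Ind2Family {Φ : signShells.PacketAut} (h : Φ ∈ signShells.Ind2Family) :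
    ActsBySigns Φ := by
  refine ⟨fun j vQ => ?_⟩
  obtain ⟨g, hg, hΦ⟩ := h j vQ
  have hs : ∀ i, ∃ s : ℚ, |s| = 1 ∧
      ∀ y : signShells.Packet1 vQ, signShells.summandwise vQ (g i) y = s • y :=
    fun i => summandwise_eq_smul vQ (g i) (hg i)
  choose s hs1 hs2 using hs
  refine ⟨∏ i, s i, abs_prod_eq_one hs1, fun x => ?_⟩
  rw [hΦ]
  exact line_factorwise_of_smul j vQ _ s hs2 x

/-- Every (Ind1)-family (a permutation of the capsule and strip-automorphisms `∈ {±1}` on every summand of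
every factor) acts by signs. [folklore] -/
theorem actsBySigns_of_mem_Ind1Family {Φ : signShells.PacketAut} (h : Φ ∈ signShells.Ind1Family) :
    ActsBySigns Φ := by
  refine ⟨fun j vQ => ?_⟩
  obtain ⟨σ, hh, hmem, hΦ⟩ := h j
  have hs : ∀ i, ∃ s : ℚ, |s| = 1 ∧ ∀ y : signShells.Packet1 vQ,
      signShells.summandwise vQ (fun v => hh i v.1) y = s • y :=
    fun i => summandwise_eq_smul vQ (fun v => hh i v.1) fun v => hmem i v.1
  choose s hs1 hs2 using hs
  refine ⟨∏ i, s i, abs_prod_eq_one hs1, fun x => ?_⟩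
  have hΦ' : Φ j vQ = (signShells.permute j vQ σ).trans
      (signShells.factorwise j vQ fun i => signShells.summandwise vQ fun v => hh i v.1) := hΦ vQ
  rw [hΦ', LinearEquiv.trans_apply, line_factorwise_of_smul j vQ _ s hs2, line_permute]

/-- The identity family acts by signs. [folklore] -/
theorem actsBySigns_one : ActsBySigns 1 := ⟨fun j vQ => ⟨1, abs_one, fun x => by rw [one_mul]; rfl⟩⟩

/-- Acting by signs is closed under composition. [folklore] -/
theorem ActsBySigns.mul {Φ Ψ : signShells.PacketAut} (hΦ : ActsBySigns Φ) (hΨ : ActsBySigns Ψ) :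
    ActsBySigns (Φ * Ψ) := by
  refine ⟨fun j vQ => ?_⟩
  obtain ⟨ε, hε, hΦε⟩ := hΦ.sign j vQ
  obtain ⟨δ, hδ, hΨδ⟩ := hΨ.sign j vQ
  refine ⟨ε * δ, by rw [abs_mul, hε, hδ, one_mul], fun x => ?_⟩
  show line j vQ (Φ j vQ (Ψ j vQ x)) = _
  rw [hΦε, hΨδ, mul_assoc]

/-- Acting by signs is closed under inverses. [folklore] -/
theorem ActsBySigns.inv {Φ : signShells.PacketAut} (hΦ : ActsBySigns Φ) : ActsBySigns Φ⁻¹ := by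
  refine ⟨fun j vQ => ?_⟩
  obtain ⟨ε, hε, hΦε⟩ := hΦ.sign j vQ
  have hε0 : ε ≠ 0 := by
    intro h; rw [h, abs_zero] at hε; exact zero_ne_one hε
  refine ⟨ε⁻¹, by rw [abs_inv, hε, inv_one], fun x => ?_⟩
  show line j vQ ((Φ j vQ).symm x) = _
  have h := hΦε ((Φ j vQ).symm x)
  rw [LinearEquiv.apply_symm_apply] at h
  rw [h, ← mul_assoc, inv_mul_cancel₀ hε0, one_mul]

/-- **Every element of the group generated by (Ind1), (Ind2) acts by signs** on the packet lines of the
sign shells (closure induction). [folklore] -/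
theorem actsBySigns_of_mem_closure {Φ : signShells.PacketAut}
    (h : Φ ∈ Subgroup.closure (signShells.Ind1Family ∪ signShells.Ind2Family)) : ActsBySigns Φ := by
  induction h using Subgroup.closure_induction with
  | mem Ψ hΨ =>
    rcases hΨ with h1 | h2
    · exact actsBySigns_of_mem_Ind1Family h1
    · exact actsBySigns_of_mem_Ind2Family h2
  | one => exact actsBySigns_one
  | mul Ψ Ψ' _ _ hΨ hΨ' => exact hΨ.mul hΨ'
  | inv Ψ _ hΨ => exact hΨ.inv

/-! ## 3. The ball: a non-empty, non-degenerate region fixed by the whole (Ind1)(Ind2)-group -/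

/-- The BALL `{x | |line x| ≤ 1}` of a packet of the sign shells — the common Θ-pilot and q-pilot image
of the witness. [folklore] -/
def ball (j : toyIndex.Label) (vQ : toyIndex.VQ) : Set (signShells.Packet j vQ) :=
  {x | |line j vQ x| ≤ 1}

/-- `0 ∈ ball`. [folklore] -/
theorem zero_mem_ball (j : toyIndex.Label) (vQ : toyIndex.VQ) : (0 : signShells.Packet j vQ) ∈ ball j vQ := by
  show |line j vQ 0| ≤ 1
  rw [map_zero, abs_zero]; exact zero_le_one

/-- The ball is nonempty. [folklore] -/
theorem ball_nonempty (j : toyIndex.Label) (vQ : toyIndex.VQ) : (ball j vQ).Nonempty :=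
  ⟨0, zero_mem_ball j vQ⟩

/-- The ball is not the zero region: the point with line coordinate `1` lies in it. [folklore] -/
theorem ball_ne_zero (j : toyIndex.Label) (vQ : toyIndex.VQ) : ball j vQ ≠ {0} := by
  intro h
  have h1 : (line j vQ).symm 1 ∈ ball j vQ := by
    show |line j vQ ((line j vQ).symm 1)| ≤ 1
    rw [LinearEquiv.apply_symm_apply, abs_one]
  rw [h, Set.mem_singleton_iff] at h1
  have h2 := congrArg (line j vQ) h1
  rw [LinearEquiv.apply_symm_apply, map_zero] at h2
  exact one_ne_zero h2

/-- The ball is not everything: the point with line coordinate `2` lies outside. [folklore] -/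
theorem ball_ne_univ (j : toyIndex.Label) (vQ : toyIndex.VQ) : ball j vQ ≠ Set.univ := by
  intro h
  have h2 : (line j vQ).symm 2 ∈ ball j vQ := by rw [h]; exact Set.mem_univ _
  have h3 : |line j vQ ((line j vQ).symm 2)| ≤ 1 := h2
  rw [LinearEquiv.apply_symm_apply] at h3
  norm_num at h3

/-- A family acting by signs FIXES the ball of every packet (as a set — not pointwise). [folklore] -/
theorem image_ball_of_actsBySigns {Φ : signShells.PacketAut} (h : ActsBySigns Φ) (j : toyIndex.Label)
    (vQ : toyIndex.VQ) : Φ j vQ '' ball j vQ = ball j vQ := by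
  obtain ⟨ε, hε, hΦ⟩ := h.sign j vQ
  apply Set.Subset.antisymm
  · rintro _ ⟨x, hx, rfl⟩
    show |line j vQ (Φ j vQ x)| ≤ 1
    rw [hΦ, abs_mul, hε, one_mul]; exact hx
  · intro x hx
    refine ⟨(Φ j vQ).symm x, ?_, LinearEquiv.apply_symm_apply _ _⟩
    have h1 := hΦ ((Φ j vQ).symm x)
    rw [LinearEquiv.apply_symm_apply] at h1
    show |line j vQ ((Φ j vQ).symm x)| ≤ 1
    have h2 : |line j vQ x| = |line j vQ ((Φ j vQ).symm x)| := by rw [h1, abs_mul, hε, one_mul]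
    rw [← h2]; exact hx

/-- The (Ind2)-family "`−1` on every summand of every factor". [folklore] -/
def negFamily : signShells.PacketAut := fun j vQ =>
  signShells.factorwise j vQ fun _ => signShells.summandwise vQ fun _ => LinearEquiv.neg ℚ

/-- … is an (Ind2)-family. [folklore] -/
theorem negFamily_mem_Ind2Family : negFamily ∈ signShells.Ind2Family := fun _ _ =>
  ⟨fun _ _ => LinearEquiv.neg ℚ, fun _ _ => Set.mem_insert_of_mem _ rfl, rfl⟩

/-- `negFamily` is the scalar `(−1)^{#S^±_{j+1}}` on the packet at label `j`. [folklore] -/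
theorem negFamily_eq_smul (j : toyIndex.Label) (vQ : toyIndex.VQ) (x : signShells.Packet j vQ) :
    negFamily j vQ x = (∏ _i : toyIndex.Caps j, (-1 : ℚ)) • x :=
  factorwise_eq_smul j vQ _ (fun _ => -1) (fun _ y => by
    rw [neg_one_smul]; funext v; rfl) x

/-- … and acts on the 1-capsule packet (label `0`) as `x ↦ −x`. [folklore] -/
theorem line_negFamily_zero (vQ : toyIndex.VQ) (x : signShells.Packet 0 vQ) :
    line 0 vQ (negFamily 0 vQ x) = -line 0 vQ x := by
  have hprod : ∏ _i : toyIndex.Caps 0, (-1 : ℚ) = -1 := by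
    show ∏ _i : Fin 1, (-1 : ℚ) = -1
    simp
  rw [negFamily_eq_smul, hprod, map_smul, smul_eq_mul, neg_one_mul]

/-- … so the (Ind1)(Ind2)-group does NOT act trivially on the packets: `negFamily` moves the point of line
coordinate `1`. [folklore] -/
theorem negFamily_moves (vQ : toyIndex.VQ) : negFamily 0 vQ ((line 0 vQ).symm 1) ≠ (line 0 vQ).symm 1 := by
  intro h
  have h2 := congrArg (line 0 vQ) h
  rw [line_negFamily_zero, LinearEquiv.apply_symm_apply] at h2
  norm_num at h2


/-- The ball is not contained in the zero region. [folklore] -/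
theorem not_ball_subset_zero (j : toyIndex.Label) (vQ : toyIndex.VQ) :
    ¬ ball j vQ ⊆ ({0} : Set (signShells.Packet j vQ)) := by
  intro h
  exact ball_ne_zero j vQ (Set.Subset.antisymm h (Set.singleton_subset_iff.mpr (zero_mem_ball j vQ)))

end IdentifiedNonVacuity

end Summit.ABC.IUTFork.Cor312

end
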